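import Summits.CriticalPhenomena.PercolationContinuityZ3.Theorems.PercNearOneGluingNoHeavyConstsLinearLowerTailStaircaseGadget
import HarnessLib

/-!
# The reach-free linear lower-tail constant: the full staircase of lower bounds `C(κ) ≥ (1 + b)/2` for `κ > 1 − 1/b`

builds on p205010 (kernel theorem, internal audit signed; external expert review pending)

PAPER-2 track "percolation constants", part (ii), seat `prim-consts-1` (lane index `run/shared/lean/prim/consts/CONSTANTS.md`,
row A19; memo `FROM-prim-consts-1-g2-RATE-WINDOW.md`).  Support file for the crux `NoHeavyLowerTail` (stmt-CriticalPhenomena-4575;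
`--supports … --as helper`): theorems only, no definitions, no sorries, standard axioms.

Notation (finite weighted graph on `Fin n`, relay set `A`, observer `o`): `N = |C(o) ∩ A|`, `EN = Σ_a P(o ↔ a)`,
`s ≥ max_{a,a'∈A} P(a ↮ a')`; `(κ, C)` is a *linear lower-tail pair* if `P(1 ≤ N < κ·EN) ≤ C·s` on every finite weighted graph
(hypothesis `hLT`, written out in full; companion files: `…ConstsNoHeavyRateHalf` — `(κ, 1/(1−κ))` is a pair;
`…ConstsLinearLowerTailRate` — a pair with `κ·C ≤ 1` gives the crux its linear rate, and `C ≥ 1` for `κ > 1/2`;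
`…ConstsLinearLowerTailHubLeaf` — `C ≥ 3/2` for `κ > 3/5`, the hub-leaf gadget on `Fin 6`).

* `Consts.half_add_half_le_const_of_gt` — **for every `b ≥ 1` and every `κ > 1 − 1/b`, every linear lower-tail pair `(κ, C)` has
  `C ≥ (1 + b)/2`.**  In particular (`Consts.three_halves_le_const_of_gt_half`) `C(κ) ≥ 3/2` on ALL of `(1/2, 1)` (the tree had
  `κ > 3/5`), `C(κ) ≥ 2` on `(2/3, 1)` (`Consts.two_le_const_of_gt_two_thirds`; the three-star of `…ConstsNoHeavyRateUpper` gives only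
  `3/2` there), `C(κ) ≥ 5/2` on `(3/4, 1)`, …: the conjectured profile `C(κ) = (1 + b(κ))/2`, `b(κ) = ⌈1/(1−κ)⌉ − 1` (conjecture
  `Consts.LinearLowerTailThreeHalves` for the first step) is a kernel LOWER bound at every `κ ∈ (0, 1)`.
  WITNESS: the hub gadget `hub(b, g)` — hub `z = 0 ∉ A`, observer `o = 1 ∈ A` joined to the hub by a spoke of weight `1 − q`,
  and `b` groups of `g` relay points each: a port joined to the hub by a spoke of weight `1 − q` and `g − 1` further points joined to
  the port by edges of weight `1`; all other pairs weight `0`; `A` = observer + all group points (`|A| = 1 + b g`).  Then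
  `s ≤ 2q` (every relay point is within one spoke of the hub), `EN ≥ 1 + b g (1 − 2q)`, and the bad event contains the `b + 1`
  disjoint cylinders "spoke `k` closed, the other `b` spokes open, all weight-`0` pairs closed" (`N = 1`, resp.
  `N ≤ 1 + (b−1) g < κ·EN` once `κ (1 + b g) > 1 + (b − 1) g`, i.e. for `g` large, since `κ b > b − 1`), of mass `q (1−q)^b` each.
  So `(b+1) q (1−q)^b ≤ 2 C q` for all small `q > 0`, i.e. `C ≥ (b+1)/2`.
The gadget is handled abstractly in the companion file `…ConstsLinearLowerTailStaircaseGadget` (`Consts.Staircase.*`: an injective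
labelling `pt : Fin b → Fin g → Fin n` of the group points, `pt i 0` the port, four hypotheses on the weights) and instantiated here on
`Fin (b g + 2)` with `g = m + 1`, hub `0`, observer `1`, `pt i r = 2 + g i + r`.  Also: `Consts.one_le_const_of_pos` (`b = 1`: `C ≥ 1` for every `κ > 0`)
and the closed form `Consts.ceil_div_two_le_const` (`C ≥ ⌈1/(1−κ)⌉/2` for `0 < κ < 1`).
References: G. Kozma, N. Nitzan, arXiv:2401.12397 (2024), Conjecture 1 (p. 3); G. Grimmett, *Percolation* (1999), §1.3.
-/

noncomputable section

namespace Summit.CriticalPhenomena.PercolationContinuityZ3.Theorems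

open MeasureTheory Set Literature.Probability.LatticeModels Literature.Probability.Percolation
open scoped Classical

namespace Consts

open Staircase HubLeaf in
/-- **The staircase: `C ≥ (1 + b)/2` for `κ > 1 − 1/b`** (`b ≥ 1`; hub gadget `hub(b, m+1)` on `Fin (b(m+1) + 2)`, see the
module docstring). [cite: KozmaNitzan2024, Conj. 1 (p. 3)] -/
theorem half_add_half_le_const_of_gt {b : ℕ} (hb : 1 ≤ b) {κ C : ℝ} (hκ : 1 - 1 / b < κ)
    (hLT : ∀ (n : ℕ) (w : Sym2 (Fin n) → unitInterval) (A : Finset (Fin n)) (o : Fin n) (s : ℝ), 0 ≤ s →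
      (∀ a ∈ A, ∀ a' ∈ A, (prodBernoulli w).real (openConn a a')ᶜ ≤ s) →
      (prodBernoulli w).real {ω : BondConfig (Fin n) | 1 ≤ (A.filter fun a => ω ∈ openConn o a).card ∧
          ((A.filter fun a => ω ∈ openConn o a).card : ℝ) < κ * (∑ a ∈ A, (prodBernoulli w).real (openConn o a))} ≤
        C * s) :
    (1 + b) / 2 ≤ C := by
  by_contra hC
  push Not at hC
  have hb0 : (0 : ℝ) < b := by exact_mod_cast hb
  have hb1 : (1 : ℝ) ≤ b := by exact_mod_cast hb
  have hκ0 : 0 < κ := by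
    have : (0 : ℝ) ≤ 1 - 1 / b := by
      rw [sub_nonneg, div_le_one hb0]; exact hb1
    linarith
  -- `γ := κ b − (b − 1) > 0`
  set γ : ℝ := κ * b - (b - 1) with hγ
  have hγ0 : 0 < γ := by
    have h := (sub_lt_iff_lt_add).1 hκ
    have : 1 * b < (κ + 1 / b) * b := mul_lt_mul_of_pos_right (by linarith) hb0
    rw [add_mul, div_mul_cancel₀ _ hb0.ne'] at this
    rw [hγ]; linarith
  -- group size `m + 1` with `(m+1) γ > 1 − κ`, room `ρ > 0`
  set m : ℕ := ⌈(1 - κ) / γ⌉₊ with hm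
  have hm1 : (1 - κ) / γ < (m : ℝ) + 1 := (Nat.le_ceil _).trans_lt (by rw [hm]; linarith)
  set ρ : ℝ := κ * (1 + b * (m + 1)) - (1 + b * (m + 1) - (m + 1)) with hρ
  have hρ0 : 0 < ρ := by
    have h1 : 1 - κ < (m + 1) * γ := by
      have := (div_lt_iff₀ hγ0).1 hm1; linarith
    have : ρ = (m + 1) * γ - (1 - κ) := by rw [hρ, hγ]; ring
    rw [this]; linarith
  -- `θ := 2C/(b+1) < 1`
  set θ : ℝ := 2 * C / (b + 1) with hθ
  have hθ1 : θ < 1 := by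
    rw [hθ, div_lt_one (by linarith)]; linarith
  -- the spoke failure probability `q`
  have hden : 0 < 4 * κ * b * (m + 1) := by positivity
  set q : ℝ := min (min (ρ / (4 * κ * b * (m + 1))) ((1 - θ) / (2 * b))) (1 / 2) with hqdef
  have hq0 : 0 < q := lt_min (lt_min (div_pos hρ0 hden) (div_pos (by linarith) (by linarith))) (by norm_num)
  have hq1 : q ≤ 1 / 2 := min_le_right _ _
  have hqρ : q ≤ ρ / (4 * κ * b * (m + 1)) := (min_le_left _ _).trans (min_le_left _ _)
  have hqθ : q ≤ (1 - θ) / (2 * b) := (min_le_left _ _).trans (min_le_right _ _)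
  have hnum : 1 + (b * (m + 1) : ℝ) - (m + 1) < κ * (1 + b * (m + 1) * (1 - 2 * q)) := by
    have h1 : q * (4 * κ * b * (m + 1)) ≤ ρ := (le_div_iff₀ hden).1 hqρ
    have : κ * (1 + b * (m + 1) * (1 - 2 * q)) - (1 + b * (m + 1) - (m + 1)) = ρ - 2 * κ * b * (m + 1) * q := by
      rw [hρ]; ring
    linarith
  have hgap : 2 * C < (b + 1) * (1 - q) ^ b := by
    have hbern : 1 + (b : ℝ) * (-q) ≤ (1 + (-q)) ^ b := one_add_mul_le_pow (by linarith) b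
    have h1 : q * (2 * b) ≤ 1 - θ := (le_div_iff₀ (by linarith)).1 hqθ
    have h2 : 2 * C = (b + 1) * θ := by rw [hθ]; field_simp
    have h3 : θ < 1 - b * q := by linarith
    rw [h2]
    have h4 : (1 : ℝ) - b * q ≤ (1 - q) ^ b := by
      have := hbern; simp only [mul_neg, ← sub_eq_add_neg] at this; exact this
    exact mul_lt_mul_of_pos_left (h3.trans_le h4) (by linarith)
  -- the gadget on `Fin (b (m+1) + 2)`: hub `0`, observer `1`, group points `2 + (m+1) i + r`
  set n : ℕ := b * (m + 1) + 2 with hn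
  have hptlt : ∀ (i : Fin b) (r : Fin (m + 1)), 2 + ((m + 1) * (i : ℕ) + r) < n := by
    intro i r
    have h1 : (m + 1) * (i : ℕ) + r < (m + 1) * ((i : ℕ) + 1) := by
      have := r.isLt; rw [Nat.mul_succ]; omega
    have h2 : (m + 1) * ((i : ℕ) + 1) ≤ (m + 1) * b := Nat.mul_le_mul_left _ (Nat.succ_le_of_lt i.isLt)
    rw [hn, Nat.mul_comm b]; omega
  set pt : Fin b → Fin (m + 1) → Fin n := fun i r => ⟨2 + ((m + 1) * (i : ℕ) + r), hptlt i r⟩ with hpt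
  have hptval : ∀ i r, ((pt i r : Fin n) : ℕ) = 2 + ((m + 1) * (i : ℕ) + r) := fun i r => rfl
  have hinj : Function.Injective fun p : Fin b × Fin (m + 1) => pt p.1 p.2 := by
    rintro ⟨i, r⟩ ⟨i', r'⟩ h
    have hv : (m + 1) * (i : ℕ) + r = (m + 1) * (i' : ℕ) + r' := by
      have := congrArg Fin.val h; simp only [hptval] at this; omega
    have hmpos : 0 < m + 1 := Nat.succ_pos m
    have hi : (i : ℕ) = i' := by
      have h1 := congrArg (· / (m + 1)) hv
      simp only [Nat.mul_add_div hmpos, Nat.div_eq_of_lt r.isLt, Nat.div_eq_of_lt r'.isLt] at h1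
      simpa using h1
    have hr : (r : ℕ) = r' := by
      have h1 := congrArg (· % (m + 1)) hv
      simp only [Nat.mul_add_mod, Nat.mod_eq_of_lt r.isLt, Nat.mod_eq_of_lt r'.isLt] at h1
      exact h1
    rw [Prod.mk.injEq]
    exact ⟨Fin.ext hi, Fin.ext hr⟩
  have hptz : ∀ i r, pt i r ≠ 0 := fun i r h => by
    have := congrArg Fin.val h; rw [hptval, Fin.val_zero] at this; omega
  have hpto : ∀ i r, pt i r ≠ 1 := fun i r h => by
    have := congrArg Fin.val h; rw [hptval, Fin.val_one] at this; omega
  have hzo : (0 : Fin n) ≠ 1 := fun h => by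
    have := congrArg Fin.val h; rw [Fin.val_zero, Fin.val_one] at this; omega
  have hport : ∀ i r, r ≠ 0 → pt i 0 ≠ pt i r := fun i r hr h => by
    have hii : (i, (0 : Fin (m + 1))) = (i, r) := hinj h
    rw [Prod.mk.injEq] at hii
    exact hr hii.2.symm
  -- weights
  have hq1' : 1 - q ∈ unitInterval := ⟨by linarith, by linarith⟩
  set qbar : unitInterval := ⟨1 - q, hq1'⟩ with hqbar
  set w : Sym2 (Fin n) → unitInterval := fun e =>
    if e = s(0, 1) ∨ ∃ i, e = s(0, pt i 0) then qbar
    else if ∃ i r, r ≠ 0 ∧ e = s(pt i 0, pt i r) then 1 else 0 with hw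
  have hwo : (w s(0, 1) : ℝ) = 1 - q := by
    simp only [hw, true_or, if_true, hqbar]
  have hwsp : ∀ i, (w s(0, pt i 0) : ℝ) = 1 - q := fun i => by
    have h : s((0 : Fin n), pt i 0) = s(0, 1) ∨ ∃ i', s((0 : Fin n), pt i 0) = s(0, pt i' 0) := Or.inr ⟨i, rfl⟩
    simp only [hw, h, if_true, hqbar]
  have hwsure : ∀ i r, r ≠ 0 → (w s(pt i 0, pt i r) : ℝ) = 1 := fun i r hr => by
    have h1 : ¬ (s(pt i 0, pt i r) = s((0 : Fin n), 1) ∨ ∃ i', s(pt i 0, pt i r) = s((0 : Fin n), pt i' 0)) := by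
      rintro (h | ⟨i', h⟩)
      · rw [Sym2.eq_iff] at h
        rcases h with ⟨h, -⟩ | ⟨h, -⟩
        · exact hptz i 0 h
        · exact hpto i 0 h
      · rw [Sym2.eq_iff] at h
        rcases h with ⟨h, -⟩ | ⟨-, h⟩
        · exact hptz i 0 h
        · exact hptz i r h
    have h2 : ∃ i' r', r' ≠ 0 ∧ s(pt i 0, pt i r) = s(pt i' 0, pt i' r') := ⟨i, r, hr, rfl⟩
    simp only [hw, h1, if_false, h2, if_true]
    rfl
  have hw0 : ∀ e, (w e : ℝ) ≠ 0 →
      e = s(0, 1) ∨ (∃ i, e = s(0, pt i 0)) ∨ (∃ i r, r ≠ 0 ∧ e = s(pt i 0, pt i r)) := by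
    intro e he
    by_cases h1 : e = s(0, 1) ∨ ∃ i, e = s(0, pt i 0)
    · rcases h1 with h | h
      · exact Or.inl h
      · exact Or.inr (Or.inl h)
    · by_cases h2 : ∃ i r, r ≠ 0 ∧ e = s(pt i 0, pt i r)
      · exact Or.inr (Or.inr h2)
      · exfalso; apply he
        simp only [hw, h1, if_false, h2]
        rfl
  set sp : Option (Fin b) → Sym2 (Fin n) := fun k => Option.elim k s(0, 1) (fun i => s(0, pt i 0)) with hsp
  have hspn : sp none = s(0, 1) := rfl
  have hsps : ∀ i, sp (some i) = s(0, pt i 0) := fun i => rfl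
  set μ := prodBernoulli w with hμ
  set A : Finset (Fin n) := insert (1 : Fin n) (Finset.univ.image fun p : Fin b × Fin (m + 1) => pt p.1 p.2) with hA
  -- pairwise unreliability `≤ 2q`
  have hs0 : (0 : ℝ) ≤ 2 * q := by linarith
  have hrel : ∀ a ∈ A, ∀ a' ∈ A, μ.real (openConn a a')ᶜ ≤ 2 * q := fun a ha a' ha' =>
    real_compl_openConn_pair_le hzo hptz hport hwo hwsp hwsure ha ha'
  have hle := hLT n w A 1 (2 * q) hs0 hrel
  -- the cylinders
  set D : Option (Fin b) → Set (BondConfig (Fin n)) := fun k =>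
    {ω : BondConfig (Fin n) | sp k ∉ ω} ∩ {ω | ∀ k', k' ≠ k → sp k' ∈ ω} ∩
      {ω | ∀ e : Sym2 (Fin n), (w e : ℝ) = 0 → e ∉ ω} with hD
  have hDbad : ∀ k, D k ⊆ {ω : BondConfig (Fin n) | 1 ≤ (A.filter fun a => ω ∈ openConn (1 : Fin n) a).card ∧
      ((A.filter fun a => ω ∈ openConn (1 : Fin n) a).card : ℝ) < κ * (∑ a ∈ A, μ.real (openConn (1 : Fin n) a))} :=
    fun k => cylinder_subset_bad hinj hzo hptz hpto hport hwo hwsp hwsure hw0 hspn hsps hb hκ0.le hnum k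
  have hDge : ∀ k, q * (1 - q) ^ b ≤ μ.real (D k) := fun k =>
    real_cylinder_ge hinj hzo hptz hpto hwo hwsp hspn hsps k
  have hdisj : (↑(Finset.univ : Finset (Option (Fin b))) : Set (Option (Fin b))).PairwiseDisjoint D := by
    intro k _ k' _ hkk'
    rw [Function.onFun, Set.disjoint_left]
    rintro ω ⟨⟨hk, -⟩, -⟩ ⟨⟨-, hk'⟩, -⟩
    exact hk (hk' k hkk')
  have hU : μ.real (⋃ k ∈ (Finset.univ : Finset (Option (Fin b))), D k) = ∑ k, μ.real (D k) :=
    measureReal_biUnion_finset hdisj (fun k _ => MeasurableSet.of_discrete)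
  have hge : (b + 1) * (q * (1 - q) ^ b) ≤ μ.real {ω : BondConfig (Fin n) |
      1 ≤ (A.filter fun a => ω ∈ openConn (1 : Fin n) a).card ∧
      ((A.filter fun a => ω ∈ openConn (1 : Fin n) a).card : ℝ) < κ * (∑ a ∈ A, μ.real (openConn (1 : Fin n) a))} := by
    calc ((b : ℝ) + 1) * (q * (1 - q) ^ b) = ∑ _k : Option (Fin b), q * (1 - q) ^ b := by
          rw [Finset.sum_const, Finset.card_univ, Fintype.card_option, Fintype.card_fin, nsmul_eq_mul]; push_cast; ring
      _ ≤ ∑ k, μ.real (D k) := Finset.sum_le_sum fun k _ => hDge k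
      _ = μ.real (⋃ k ∈ (Finset.univ : Finset (Option (Fin b))), D k) := hU.symm
      _ ≤ _ := measureReal_mono (Set.iUnion₂_subset fun k _ => hDbad k) (measure_ne_top _ _)
  -- `(b+1) q (1−q)^b ≤ 2 C q` contradicts `hgap`
  have h1 : (b + 1) * (1 - q) ^ b * q ≤ 2 * C * q := by linarith
  have h2 := le_of_mul_le_mul_right h1 hq0
  linarith

/-- **`C(κ) ≥ 3/2` on all of `(1/2, 1)`**: for `κ > 1/2` every linear lower-tail pair `(κ, C)` has `C ≥ 3/2` (the case `b = 2`;
`…ConstsLinearLowerTailHubLeaf` needed `κ > 3/5`).  With the conjecture `Consts.LinearLowerTailThreeHalves` this would be an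
equality on `(1/2, 2/3]`. [cite: KozmaNitzan2024, Conj. 1 (p. 3)] -/
theorem three_halves_le_const_of_gt_half {κ C : ℝ} (hκ : 1 / 2 < κ)
    (hLT : ∀ (n : ℕ) (w : Sym2 (Fin n) → unitInterval) (A : Finset (Fin n)) (o : Fin n) (s : ℝ), 0 ≤ s →
      (∀ a ∈ A, ∀ a' ∈ A, (prodBernoulli w).real (openConn a a')ᶜ ≤ s) →
      (prodBernoulli w).real {ω : BondConfig (Fin n) | 1 ≤ (A.filter fun a => ω ∈ openConn o a).card ∧
          ((A.filter fun a => ω ∈ openConn o a).card : ℝ) < κ * (∑ a ∈ A, (prodBernoulli w).real (openConn o a))} ≤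
        C * s) :
    3 / 2 ≤ C := by
  have h := half_add_half_le_const_of_gt (b := 2) (by norm_num) (by norm_num; linarith) hLT
  norm_num at h
  exact h

/-- **`C(κ) ≥ 2` on `(2/3, 1)`**: for `κ > 2/3` every linear lower-tail pair `(κ, C)` has `C ≥ 2` (the case `b = 3`; the
three-star witness of `…ConstsNoHeavyRateUpper` gives only `3/2` there). [cite: KozmaNitzan2024, Conj. 1 (p. 3)] -/
theorem two_le_const_of_gt_two_thirds {κ C : ℝ} (hκ : 2 / 3 < κ)
    (hLT : ∀ (n : ℕ) (w : Sym2 (Fin n) → unitInterval) (A : Finset (Fin n)) (o : Fin n) (s : ℝ), 0 ≤ s →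
      (∀ a ∈ A, ∀ a' ∈ A, (prodBernoulli w).real (openConn a a')ᶜ ≤ s) →
      (prodBernoulli w).real {ω : BondConfig (Fin n) | 1 ≤ (A.filter fun a => ω ∈ openConn o a).card ∧
          ((A.filter fun a => ω ∈ openConn o a).card : ℝ) < κ * (∑ a ∈ A, (prodBernoulli w).real (openConn o a))} ≤
        C * s) :
    2 ≤ C := by
  have h := half_add_half_le_const_of_gt (b := 3) (by norm_num) (by norm_num; linarith) hLT
  norm_num at h
  exact h

/-- **`C ≥ 1` for every `κ > 0`** (the case `b = 1`: observer – hub – one glued group; `…ConstsLinearLowerTailRate` had this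
for `κ > 1/2` via the series graph). [cite: KozmaNitzan2024, Conj. 1 (p. 3)] -/
theorem one_le_const_of_pos {κ C : ℝ} (hκ : 0 < κ)
    (hLT : ∀ (n : ℕ) (w : Sym2 (Fin n) → unitInterval) (A : Finset (Fin n)) (o : Fin n) (s : ℝ), 0 ≤ s →
      (∀ a ∈ A, ∀ a' ∈ A, (prodBernoulli w).real (openConn a a')ᶜ ≤ s) →
      (prodBernoulli w).real {ω : BondConfig (Fin n) | 1 ≤ (A.filter fun a => ω ∈ openConn o a).card ∧
          ((A.filter fun a => ω ∈ openConn o a).card : ℝ) < κ * (∑ a ∈ A, (prodBernoulli w).real (openConn o a))} ≤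
        C * s) :
    1 ≤ C := by
  have h := half_add_half_le_const_of_gt (b := 1) le_rfl (by norm_num; linarith) hLT
  norm_num at h
  exact h

/-- **The staircase in closed form**: for `0 < κ < 1` every linear lower-tail pair `(κ, C)` has `C ≥ ⌈1/(1−κ)⌉₊ / 2`
(`= (1 + b(κ))/2` with `b(κ) = ⌈1/(1−κ)⌉ − 1` the number of steps below `κ`). [cite: KozmaNitzan2024, Conj. 1 (p. 3)] -/
theorem ceil_div_two_le_const {κ C : ℝ} (hκ0 : 0 < κ) (hκ1 : κ < 1)
    (hLT : ∀ (n : ℕ) (w : Sym2 (Fin n) → unitInterval) (A : Finset (Fin n)) (o : Fin n) (s : ℝ), 0 ≤ s →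
      (∀ a ∈ A, ∀ a' ∈ A, (prodBernoulli w).real (openConn a a')ᶜ ≤ s) →
      (prodBernoulli w).real {ω : BondConfig (Fin n) | 1 ≤ (A.filter fun a => ω ∈ openConn o a).card ∧
          ((A.filter fun a => ω ∈ openConn o a).card : ℝ) < κ * (∑ a ∈ A, (prodBernoulli w).real (openConn o a))} ≤
        C * s) :
    (⌈1 / (1 - κ)⌉₊ : ℝ) / 2 ≤ C := by
  -- `b := ⌈1/(1−κ)⌉₊ − 1 ≥ 1` satisfies `b < 1/(1−κ)`, i.e. `1 − 1/b < κ`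
  have h1κ : 0 < 1 - κ := by linarith
  have hx1 : 1 < 1 / (1 - κ) := by rw [lt_div_iff₀ h1κ]; linarith
  set c : ℕ := ⌈1 / (1 - κ)⌉₊ with hc
  have hc2 : 2 ≤ c := by
    have : (1 : ℝ) < c := hx1.trans_le (Nat.le_ceil _)
    have : 1 < c := by exact_mod_cast this
    omega
  have hb : 1 ≤ c - 1 := by omega
  have hlt : ((c - 1 : ℕ) : ℝ) < 1 / (1 - κ) := by
    have := Nat.ceil_lt_add_one (show (0 : ℝ) ≤ 1 / (1 - κ) by positivity)
    rw [← hc] at this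
    push_cast [Nat.cast_sub (by omega : 1 ≤ c)]
    linarith
  have hκb : 1 - 1 / ((c - 1 : ℕ) : ℝ) < κ := by
    have hbpos : (0 : ℝ) < ((c - 1 : ℕ) : ℝ) := by exact_mod_cast hb
    have h2 : ((c - 1 : ℕ) : ℝ) * (1 - κ) < 1 := (lt_div_iff₀ h1κ).1 hlt
    rw [sub_lt_comm, lt_div_iff₀ hbpos]
    nlinarith
  have h := half_add_half_le_const_of_gt hb hκb hLT
  have hcast : (1 : ℝ) + ((c - 1 : ℕ) : ℝ) = c := by
    push_cast [Nat.cast_sub (by omega : 1 ≤ c)]; ring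
  rw [hcast] at h
  exact h

end Consts

end Summit.CriticalPhenomena.PercolationContinuityZ3.Theorems
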